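import Mathlib.RingTheory.RootsOfUnity.Complex
import Mathlib.Analysis.SpecialFunctions.Pow.Real
import Mathlib.Analysis.SpecialFunctions.Exponential
import Mathlib.Analysis.Complex.Exponential
import Mathlib.Analysis.Complex.ExponentialBounds
import Mathlib.NumberTheory.Divisors
import Mathlib.Topology.Algebra.InfiniteSum.Real
import Mathlib.Analysis.Normed.Group.InfiniteSum
import Mathlib.Analysis.SpecificLimits.Basic
import Mathlib.Analysis.PSeries
import Mathlib.Data.Set.Finite.Basic
import HarnessLib

/-!
# The rigid polygon TOWER, part A: the residual recursion, exact moment cancellation, finite mass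

Cell `rh-split`, K-task «TOWER» (lead RULING #329; spec = rh-idea-5 g2's `TOWER-BARRIER.md` §1 + §5,
sha16 b241d1db4bf38dc5; barrier candidate B26 «TOWER BARRIER», B16-bis).  ζ-free and RH-free: pure
analysis/combinatorics.  Architecture adapted from the tree's divisor-ring kernel
`Splittings/ScrewWolffDiscreteData{A,B,C}` (screw-bridge g15) — here the ring directions are REAL SIGNS
(rotation `0` or `π/n`) and the radii are `1 - 1/(c n)` instead of `q^{1/n}`.

## The construction (memo §1, exact weights)

Fix a depth `c > 0` and a seed order `K₀` with `c K₀ ≥ 1`.  Radii `r_n = 1 - 1/(c n)`.  Seed: the regular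
`K₀`-gon `{r_{K₀} e^{2πij/K₀}}` with vertex mass `1/K₀` (its `k`-th moment is `[K₀ ∣ k] r_{K₀}^k`).  For
`n = K₀, K₀+1, …` let `x_n` (`res c K₀ n` below) be the `n`-th moment of everything placed so far; the step adds
the regular `n`-gon at radius `r_n`, rotation `0` if `x_n < 0` and `π/n` if `x_n > 0`, vertex mass
`|x_n|/(n r_nⁿ)` (nothing if `x_n = 0`).  A gon of order `d` built on the residual `x` contributes
`|x|·r_d^{k-d}·(-sign x)^{k/d}` at the frequencies `k` divisible by `d` and nothing elsewhere (`term`), so the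
step kills moment `n` and never touches the moments `< n`: EVERY moment `k ≥ 1` of the infinite tower vanishes
(`moment_cancel`).  All masses are positive and the configuration is real (closed under conjugation).

## Finite mass (this file: depth `c ≤ 1/3`)

`|x_n| ≤ [K₀ ∣ n] r_{K₀}ⁿ + Σ_{d ∣ n, K₀ ≤ d < n} |x_d| r_d^{n-d}` and `r_d^{n-d} ≤ e^{-(n/d-1)/c}`; for
`e^{-1/c} ≤ 1/18` (e.g. `c ≤ 1/3`) the strong induction `|x_n| ≤ B/n²` closes with `B = 12 (c K₀)³`
(`abs_res_le`), whence `Σ_n |x_n| < ∞` (`summable_abs_res`).  The memo's full range `c < 1/ln 2` needs the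
partial-sum majorant `S ≤ A + S/(e^{1/c} - 1)` instead — not formalised here; the barrier's regime of interest is
`c ↓ 0` (weight-count exponent `w = c·ln 2/(1 + c·ln 2) ↓ 0`, memo §1 (v); the exponent itself is not formalised
in this file either).  Nothing here bears on the truth of RH.
-/

set_option linter.dupNamespace false

namespace Summit.RiemannHypothesis.RiemannHypothesis.Theorems.Splittings.ScrewLatticeTower

open Finset Filter Topology

noncomputable section

/-! ## 1. Radii -/

/-- The radius of the gon of order `n` at depth `c`: `r_n = 1 - 1/(c n)`. -/
def rad (c : ℝ) (n : ℕ) : ℝ := 1 - 1 / (c * n)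

/-- `r_n < 1`. -/
theorem rad_lt_one {c : ℝ} (hc : 0 < c) {n : ℕ} (hn : 1 ≤ n) : rad c n < 1 := by
  have : (0 : ℝ) < n := by exact_mod_cast hn
  have : 0 < 1 / (c * n) := by positivity
  rw [rad]; linarith

/-- `0 < r_n` as soon as `c n > 1`. -/
theorem rad_pos {c : ℝ} {n : ℕ} (hn : 1 < c * n) : 0 < rad c n := by
  have hcn : 0 < c * n := by linarith
  rw [rad, sub_pos, div_lt_one hcn]; exact hn

/-- `0 ≤ r_n` as soon as `c n ≥ 1`. -/
theorem rad_nonneg {c : ℝ} {n : ℕ} (hn : 1 ≤ c * n) : 0 ≤ rad c n := by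
  have hcn : 0 < c * n := by linarith
  rw [rad, sub_nonneg, div_le_one hcn]; exact hn

/-- The radii increase with the order. -/
theorem rad_lt_rad {c : ℝ} (hc : 0 < c) {n n' : ℕ} (hn : 1 ≤ n) (h : n < n') : rad c n < rad c n' := by
  have hn0 : (0 : ℝ) < n := by exact_mod_cast hn
  have hnn : (n : ℝ) < n' := by exact_mod_cast h
  rw [rad, rad]
  have h1 : 1 / (c * n') < 1 / (c * n) := by
    apply one_div_lt_one_div_of_lt (by positivity); nlinarith
  linarith

/-- The radii are monotone in the order. -/
theorem rad_le_rad {c : ℝ} (hc : 0 < c) {n n' : ℕ} (hn : 1 ≤ n) (h : n ≤ n') : rad c n ≤ rad c n' := by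
  rcases h.lt_or_eq with h | h
  · exact (rad_lt_rad hc hn h).le
  · rw [h]

/-- `r_n ≤ e^{-1/(c n)}`. -/
theorem rad_le_exp {c : ℝ} (n : ℕ) : rad c n ≤ Real.exp (-(1 / (c * n))) := by
  have := Real.add_one_le_exp (-(1 / (c * n)))
  rw [rad]; linarith

/-- The decay factor of a gon of order `d` seen at the multiple `d·t`: `r_d^{d t - d} ≤ (e^{-1/c})^{t-1}`. -/
theorem rad_pow_le {c : ℝ} {d t : ℕ} (hd : 1 ≤ c * d) :
    rad c d ^ (d * t - d) ≤ Real.exp (-(1 / c)) ^ (t - 1) := by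
  have hd0 : (0 : ℝ) < d := by
    rcases Nat.eq_zero_or_pos d with h | h
    · subst h; simp at hd; linarith
    · exact_mod_cast h
  have hdt : d * t - d = d * (t - 1) := by
    rw [Nat.mul_sub_one]
  rw [hdt, pow_mul]
  apply pow_le_pow_left₀ (pow_nonneg (rad_nonneg hd) _)
  calc rad c d ^ d ≤ Real.exp (-(1 / (c * d))) ^ d :=
        pow_le_pow_left₀ (rad_nonneg hd) (rad_le_exp d) d
    _ = Real.exp (-(1 / c)) := by
        rw [← Real.exp_nat_mul]
        congr 1
        field_simp
/-- The radii tend to `1`: for every `ρ < 1` some `r_N` exceeds `ρ` (with `N` as large as we please). -/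
theorem exists_rad_gt {c : ℝ} (hc : 0 < c) {ρ : ℝ} (hρ : ρ < 1) (B : ℕ) : ∃ N : ℕ, B < N ∧ ρ < rad c N := by
  obtain ⟨N, hN⟩ := exists_nat_gt (max (B : ℝ) (1 / (c * (1 - ρ))))
  have hB : (B : ℝ) < N := (le_max_left _ _).trans_lt hN
  have h1 : 1 / (c * (1 - ρ)) < N := (le_max_right _ _).trans_lt hN
  refine ⟨N, by exact_mod_cast hB, ?_⟩
  have hρ1 : 0 < 1 - ρ := by linarith
  have hN0 : (0 : ℝ) < N := lt_of_le_of_lt (by positivity) h1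
  rw [rad]
  rw [div_lt_iff₀ (by positivity)] at h1
  have : 1 / (c * N) < 1 - ρ := by
    rw [div_lt_iff₀ (by positivity)]; nlinarith
  linarith

/-! ## 2. The gon terms and the residual recursion -/

/-- The direction sign of the gon built on the residual `x`: `-1` (rotation `π/d`) if `x > 0`, `+1` (rotation
`0`) otherwise. -/
def sgn (x : ℝ) : ℝ := if 0 < x then -1 else 1

/-- `|sgn x| = 1`. -/
theorem abs_sgn (x : ℝ) : |sgn x| = 1 := by
  unfold sgn; split_ifs <;> simp

/-- `|x| · sgn x = -x`. -/
theorem abs_mul_sgn (x : ℝ) : |x| * sgn x = -x := by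
  unfold sgn
  split_ifs with h
  · rw [abs_of_pos h]; ring
  · rw [abs_of_nonpos (not_lt.mp h)]; ring

/-- The contribution, at frequency `k`, of the gon of order `d` built on the residual `x`:
`|x|·r_d^{k-d}·(sgn x)^{k/d}` (meaningful at the multiples `k` of `d`). -/
def term (c : ℝ) (d : ℕ) (x : ℝ) (k : ℕ) : ℝ := |x| * rad c d ^ (k - d) * sgn x ^ (k / d)

/-- A dead gon (`x = 0`) contributes nothing. -/
theorem term_zero (c : ℝ) (d k : ℕ) : term c d 0 k = 0 := by simp [term]

/-- At its own frequency the gon cancels its residual: `term c d x d = -x`. -/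
theorem term_self (c : ℝ) {d : ℕ} (hd : 1 ≤ d) (x : ℝ) : term c d x d = -x := by
  rw [term, Nat.sub_self, pow_zero, mul_one, Nat.div_self hd, pow_one, abs_mul_sgn]

/-- Size of a gon term: `|term c d x k| ≤ |x| · r_d^{k-d}` (when `r_d ≥ 0`). -/
theorem abs_term_le {c : ℝ} {d : ℕ} (hd : 1 ≤ c * d) (x : ℝ) (k : ℕ) :
    |term c d x k| ≤ |x| * rad c d ^ (k - d) := by
  rw [term, abs_mul, abs_mul, abs_abs, abs_pow, abs_of_nonneg (rad_nonneg hd), abs_pow, abs_sgn, one_pow,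
    mul_one]

/-- The seed moment at frequency `k`: `[K₀ ∣ k] r_{K₀}^k` (the `K₀`-gon of vertex mass `1/K₀`, rotation `0`). -/
def seedMom (c : ℝ) (K₀ k : ℕ) : ℝ := if K₀ ∣ k then rad c K₀ ^ k else 0

/-- `|seedMom| ≤ r_{K₀}^k` (when `r_{K₀} ≥ 0`). -/
theorem abs_seedMom_le {c : ℝ} {K₀ : ℕ} (hK : 1 ≤ c * K₀) (k : ℕ) :
    |seedMom c K₀ k| ≤ rad c K₀ ^ k := by
  unfold seedMom
  split_ifs
  · rw [abs_of_nonneg (pow_nonneg (rad_nonneg hK) _)]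
  · rw [abs_zero]; exact pow_nonneg (rad_nonneg hK) _

/-- The residuals `x_n` (memo §1): `0` below the seed order; for `n ≥ K₀` the `n`-th moment of the seed and of
all gons of order `K₀ ≤ d < n` (well-founded recursion over the proper divisors). -/
def res (c : ℝ) (K₀ : ℕ) : ℕ → ℝ
  | n => if n < K₀ then 0 else
      seedMom c K₀ n + ∑ d ∈ (Nat.properDivisors n).attach,
        (have := (Nat.mem_properDivisors.1 d.2).2
         if K₀ ≤ d.1 then term c d.1 (res c K₀ d.1) n else 0)
termination_by n => n
decreasing_by exact (Nat.mem_properDivisors.1 d.2).2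

/-- The sum over the proper divisors `d ≥ K₀` of `n` of the gon terms. -/
def gonSum (c : ℝ) (K₀ n : ℕ) : ℝ :=
  ∑ d ∈ Nat.properDivisors n, if K₀ ≤ d then term c d (res c K₀ d) n else 0

/-- Below the seed order there is no residual. -/
theorem res_of_lt {c : ℝ} {K₀ n : ℕ} (hn : n < K₀) : res c K₀ n = 0 := by
  rw [res.eq_def]; simp [hn]

/-- The defining recursion, unfolded at `n ≥ K₀`. -/
theorem res_eq {c : ℝ} {K₀ n : ℕ} (hn : K₀ ≤ n) : res c K₀ n = seedMom c K₀ n + gonSum c K₀ n := by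
  rw [res.eq_def, if_neg (by omega), gonSum]
  congr 1
  exact Finset.sum_attach (Nat.properDivisors n) (fun d ↦ if K₀ ≤ d then term c d (res c K₀ d) n else 0)

/-- A live gon has order at least `K₀`. -/
theorem le_of_res_ne_zero {c : ℝ} {K₀ n : ℕ} (hn : res c K₀ n ≠ 0) : K₀ ≤ n := by
  by_contra h
  exact hn (res_of_lt (by omega))

/-- **Exact moment cancellation at every frequency `k ≥ 1`** (for `K₀ ≥ 1`):
`[K₀ ∣ k] r_{K₀}^k + Σ_{d ∣ k, K₀ ≤ d} term c d (x_d) k = 0` — the `d = k` term is `-x_k`. -/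
theorem moment_cancel {c : ℝ} {K₀ : ℕ} {k : ℕ} (hk : 1 ≤ k) :
    seedMom c K₀ k + ∑ d ∈ Nat.divisors k, (if K₀ ≤ d then term c d (res c K₀ d) k else 0) = 0 := by
  rcases Nat.lt_or_ge k K₀ with hkK | hkK
  · -- below the seed order: no seed moment, no gon divides `k`
    have h1 : seedMom c K₀ k = 0 := by
      rw [seedMom, if_neg]
      exact fun h ↦ absurd (Nat.le_of_dvd (by omega) h) (by omega)
    rw [h1, zero_add]
    refine Finset.sum_eq_zero fun d hd ↦ ?_
    rw [if_neg]
    have := Nat.divisor_le hd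
    omega
  · rw [← Nat.insert_self_properDivisors (by omega), Finset.sum_insert Nat.self_notMem_properDivisors,
      if_pos hkK, term_self c hk, res_eq hkK, gonSum]
    ring

/-! ## 3. The mass bound `|x_n| ≤ B/n²` for `e^{-1/c} ≤ 1/18` -/

/-- `t² ≤ 2^{t+1}` for every natural number `t`. -/
theorem sq_le_two_pow (t : ℕ) : t ^ 2 ≤ 2 ^ (t + 1) := by
  induction t with
  | zero => norm_num
  | succ n ih =>
    have h1 : n < 2 ^ n := Nat.lt_two_pow_self
    calc (n + 1) ^ 2 = n ^ 2 + (2 * n + 1) := by ring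
      _ ≤ 2 ^ (n + 1) + 2 ^ (n + 1) := by
          apply add_le_add ih
          rw [pow_succ]; omega
      _ = 2 ^ (n + 1 + 1) := by rw [pow_succ]; ring

/-- The weighted tail: `Σ_{m ≤ n} [2 ≤ m] m² x^{m-1} ≤ 1/2` for `0 ≤ x ≤ 1/18`. -/
theorem sum_sq_mul_pow_le {x : ℝ} (hx0 : 0 ≤ x) (hx : x ≤ 1 / 18) (n : ℕ) :
    ∑ m ∈ Finset.range (n + 1), (if 2 ≤ m then (m : ℝ) ^ 2 * x ^ (m - 1) else 0) ≤ 1 / 2 := by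
  -- termwise `m² x^{m-1} ≤ 4 (2x)^{m-1} ≤ 4 (1/9)^{m-1}`, and `Σ_{m ≥ 2} 4 (1/9)^{m-1} ≤ 1/2`
  have hterm : ∀ m : ℕ, (if 2 ≤ m then ((m : ℕ) : ℝ) ^ 2 * x ^ (m - 1) else 0)
      ≤ (if 2 ≤ m then 4 * (1 / 9 : ℝ) ^ (m - 1) else 0) := by
    intro m
    split_ifs with hm
    · have h1 : ((m : ℕ) : ℝ) ^ 2 ≤ 2 ^ (m + 1) := by exact_mod_cast sq_le_two_pow m
      have h2 : (2 : ℝ) ^ (m + 1) = 4 * 2 ^ (m - 1) := by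
        rw [show m + 1 = (m - 1) + 2 by omega, pow_add]; ring
      have h3 : (2 * x) ^ (m - 1) ≤ (1 / 9 : ℝ) ^ (m - 1) :=
        pow_le_pow_left₀ (by positivity) (by linarith) _
      calc ((m : ℕ) : ℝ) ^ 2 * x ^ (m - 1) ≤ 2 ^ (m + 1) * x ^ (m - 1) := by gcongr
        _ = 4 * (2 * x) ^ (m - 1) := by rw [h2, mul_pow]; ring
        _ ≤ 4 * (1 / 9 : ℝ) ^ (m - 1) := by linarith
    · exact le_rfl
  refine (Finset.sum_le_sum fun m _ ↦ hterm m).trans ?_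
  -- the geometric majorant
  have hgeom : ∀ N : ℕ, ∑ m ∈ Finset.range (N + 1), (if 2 ≤ m then 4 * (1 / 9 : ℝ) ^ (m - 1) else 0)
      ≤ 1 / 2 - (1 / 2) * (1 / 9 : ℝ) ^ (N - 1) := by
    intro N
    induction N with
    | zero => norm_num
    | succ N ih =>
      rw [Finset.sum_range_succ]
      rcases Nat.lt_or_ge (N + 1) 2 with hN | hN
      · have hN0 : N = 0 := by omega
        subst hN0
        norm_num [Finset.sum_range_succ]
      · rw [if_pos hN, show N + 1 - 1 = N from rfl]
        have hN1 : N - 1 + 1 = N := by omega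
        have hpow : (1 / 9 : ℝ) ^ N = (1 / 9) ^ (N - 1) * (1 / 9) := by
          rw [← pow_succ, hN1]
        rw [hpow] at *
        nlinarith [ih, pow_nonneg (by norm_num : (0 : ℝ) ≤ 1 / 9) (N - 1)]
  have := hgeom n
  nlinarith [pow_nonneg (by norm_num : (0 : ℝ) ≤ 1 / 9) (n - 1)]

/-- The seed decay: `r_{K₀}ⁿ ≤ 6 (c K₀)³ / n³` (from `e^u ≥ u³/6`). -/
theorem rad_pow_le_cube {c : ℝ} (hc : 0 < c) {K₀ : ℕ} (hK : 1 ≤ c * K₀) {n : ℕ} (hn : 1 ≤ n) :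
    rad c K₀ ^ n ≤ 6 * (c * K₀) ^ 3 / (n : ℝ) ^ 3 := by
  have hn0 : (0 : ℝ) < n := by exact_mod_cast hn
  have hcK : 0 < c * K₀ := by linarith
  set u : ℝ := n / (c * K₀) with hu
  have hu0 : 0 ≤ u := by positivity
  have h1 : rad c K₀ ^ n ≤ Real.exp (-u) := by
    calc rad c K₀ ^ n ≤ Real.exp (-(1 / (c * K₀))) ^ n :=
          pow_le_pow_left₀ (rad_nonneg hK) (rad_le_exp K₀) n
      _ = Real.exp (-u) := by rw [← Real.exp_nat_mul]; congr 1; rw [hu]; field_simp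
  have h2 : u ^ 3 / 6 ≤ Real.exp u := by
    have := Real.pow_div_factorial_le_exp (hx := hu0) (n := 3)
    simpa [Nat.factorial] using this
  have h3 : Real.exp (-u) ≤ 6 / u ^ 3 := by
    have hu3 : 0 < u ^ 3 := by positivity
    rw [Real.exp_neg, inv_eq_one_div, div_le_div_iff₀ (Real.exp_pos u) hu3]
    linarith
  calc rad c K₀ ^ n ≤ 6 / u ^ 3 := h1.trans h3
    _ = 6 * (c * K₀) ^ 3 / (n : ℝ) ^ 3 := by rw [hu]; field_simp

/-- **The mass bound**: if `e^{-1/c} ≤ 1/18` (e.g. `c ≤ 1/3`) and `c K₀ ≥ 1` then `|x_n| ≤ 12 (c K₀)³ / n²`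
for every `n` (recall `x_n = 0` below `K₀`, and `1/0² = 0` in Lean). -/
theorem abs_res_le {c : ℝ} (hc : 0 < c) (hx : Real.exp (-(1 / c)) ≤ 1 / 18) {K₀ : ℕ} (hK : 1 ≤ c * K₀)
    (n : ℕ) : |res c K₀ n| ≤ 12 * (c * K₀) ^ 3 / (n : ℝ) ^ 2 := by
  set B : ℝ := 12 * (c * K₀) ^ 3 with hB
  set x : ℝ := Real.exp (-(1 / c)) with hxdef
  have hx0 : 0 ≤ x := (Real.exp_pos _).le
  have hcK : 0 < c * K₀ := by linarith
  have hK1 : 1 ≤ K₀ := by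
    by_contra h
    have : K₀ = 0 := by omega
    subst this; simp at hK; linarith
  induction n using Nat.strong_induction_on with
  | _ n ih =>
    rcases Nat.lt_or_ge n K₀ with hn | hn
    · rw [res_of_lt hn, abs_zero]; positivity
    have hn1 : 1 ≤ n := le_trans hK1 hn
    have hn0 : (0 : ℝ) < n := by exact_mod_cast hn1
    -- the gon terms: each at most `(B/n²)·F(n/d)` with `F m = [2 ≤ m] m² x^{m-1}`
    set F : ℕ → ℝ := fun m ↦ if 2 ≤ m then (m : ℝ) ^ 2 * x ^ (m - 1) else 0 with hF
    have hF0 : ∀ m, 0 ≤ F m := fun m ↦ by simp only [hF]; split_ifs <;> positivity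
    have hsummand : ∀ d ∈ Nat.properDivisors n,
        |(if K₀ ≤ d then term c d (res c K₀ d) n else 0)| ≤ B / (n : ℝ) ^ 2 * F (n / d) := by
      intro d hd
      obtain ⟨hdn, hdlt⟩ := Nat.mem_properDivisors.1 hd
      split_ifs with hKd
      · set m := n / d with hm
        have hdm : d * m = n := Nat.mul_div_cancel' hdn
        have hd1 : 1 ≤ d := le_trans hK1 hKd
        have hm2 : 2 ≤ m := by
          by_contra hlt
          interval_cases m <;> omega
        have hd0 : (0 : ℝ) < d := by exact_mod_cast hd1
        have hm0 : (0 : ℝ) < m := by exact_mod_cast (show 0 < m by omega)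
        have hdm' : (d : ℝ) * m = n := by exact_mod_cast hdm
        have hcd : 1 ≤ c * d := le_trans hK (by gcongr)
        have hFm : F m = (m : ℝ) ^ 2 * x ^ (m - 1) := by simp [hF, hm2]
        have hdecay : rad c d ^ (n - d) ≤ x ^ (m - 1) := by
          rw [← hdm]; exact rad_pow_le hcd
        calc |term c d (res c K₀ d) n| ≤ |res c K₀ d| * rad c d ^ (n - d) := abs_term_le hcd _ _
          _ ≤ B / (d : ℝ) ^ 2 * x ^ (m - 1) :=
              mul_le_mul (ih d hdlt) hdecay (pow_nonneg (rad_nonneg hcd) _) (by positivity)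
          _ = B / (n : ℝ) ^ 2 * ((m : ℝ) ^ 2 * x ^ (m - 1)) := by rw [← hdm']; field_simp
          _ = B / (n : ℝ) ^ 2 * F (n / d) := by rw [hFm]
      · rw [abs_zero]; exact mul_nonneg (by positivity) (hF0 _)
    have hsumF : ∑ d ∈ Nat.properDivisors n, F (n / d) ≤ 1 / 2 := by
      calc ∑ d ∈ Nat.properDivisors n, F (n / d) ≤ ∑ d ∈ Nat.divisors n, F (n / d) :=
            Finset.sum_le_sum_of_subset_of_nonneg (Nat.properDivisors_subset_divisors) fun _ _ _ ↦ hF0 _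
        _ = ∑ d ∈ Nat.divisors n, F d := Nat.sum_div_divisors n F
        _ ≤ ∑ m ∈ Finset.range (n + 1), F m :=
            Finset.sum_le_sum_of_subset_of_nonneg (fun d hd ↦ Finset.mem_range.2
              (Nat.lt_succ_of_le (Nat.divisor_le hd))) fun _ _ _ ↦ hF0 _
        _ ≤ 1 / 2 := sum_sq_mul_pow_le hx0 hx n
    -- the seed term: `r_{K₀}ⁿ ≤ 6(cK₀)³/n³ ≤ (B/2)/n²`
    have hseed : |seedMom c K₀ n| ≤ B / (n : ℝ) ^ 2 * (1 / 2) := by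
      refine (abs_seedMom_le hK n).trans ((rad_pow_le_cube hc hK hn1).trans ?_)
      rw [hB]
      have h1 : (1 : ℝ) ≤ n := by exact_mod_cast hn1
      have hn3 : (n : ℝ) ^ 2 ≤ (n : ℝ) ^ 3 := by nlinarith
      have hcK3 : 0 ≤ 6 * (c * K₀) ^ 3 := by positivity
      calc 6 * (c * K₀) ^ 3 / (n : ℝ) ^ 3 ≤ 6 * (c * K₀) ^ 3 / (n : ℝ) ^ 2 :=
            div_le_div_of_nonneg_left hcK3 (by positivity) hn3
        _ = 12 * (c * K₀) ^ 3 / (n : ℝ) ^ 2 * (1 / 2) := by ring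
    -- assemble
    rw [res_eq hn]
    calc |seedMom c K₀ n + gonSum c K₀ n| ≤ |seedMom c K₀ n| + |gonSum c K₀ n| := abs_add_le _ _
      _ ≤ B / (n : ℝ) ^ 2 * (1 / 2)
          + ∑ d ∈ Nat.properDivisors n, |(if K₀ ≤ d then term c d (res c K₀ d) n else 0)| :=
          add_le_add hseed (Finset.abs_sum_le_sum_abs _ _)
      _ ≤ B / (n : ℝ) ^ 2 * (1 / 2) + ∑ d ∈ Nat.properDivisors n, B / (n : ℝ) ^ 2 * F (n / d) :=
          add_le_add le_rfl (Finset.sum_le_sum hsummand)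
      _ = B / (n : ℝ) ^ 2 * (1 / 2 + ∑ d ∈ Nat.properDivisors n, F (n / d)) := by
          rw [mul_add, Finset.mul_sum]
      _ ≤ B / (n : ℝ) ^ 2 * (1 / 2 + 1 / 2) := by gcongr
      _ = B / (n : ℝ) ^ 2 := by ring

/-- The residuals are absolutely summable: `Σ_n |x_n| < ∞`. -/
theorem summable_abs_res {c : ℝ} (hc : 0 < c) (hx : Real.exp (-(1 / c)) ≤ 1 / 18) {K₀ : ℕ}
    (hK : 1 ≤ c * K₀) : Summable (fun n : ℕ ↦ |res c K₀ n|) := by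
  refine Summable.of_nonneg_of_le (fun _ ↦ abs_nonneg _) (abs_res_le hc hx hK) ?_
  have h := (Real.summable_one_div_nat_pow.mpr one_lt_two).mul_left (12 * (c * K₀) ^ 3)
  have heq : (fun n : ℕ ↦ 12 * (c * K₀) ^ 3 / (n : ℝ) ^ 2) = fun n : ℕ ↦ 12 * (c * K₀) ^ 3 * (1 / (n : ℝ) ^ 2) := by
    funext n; rw [mul_one_div]
  rw [heq]; exact h

/-- Depth `c ≤ 1/3` is admissible: `e^{-1/c} ≤ e^{-3} ≤ 1/18`. -/
theorem exp_neg_inv_le {c : ℝ} (hc : 0 < c) (hc3 : c ≤ 1 / 3) : Real.exp (-(1 / c)) ≤ 1 / 18 := by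
  have h3 : (3 : ℝ) ≤ 1 / c := by rw [le_div_iff₀ hc]; linarith
  calc Real.exp (-(1 / c)) ≤ Real.exp (-3) := Real.exp_le_exp.mpr (by linarith)
    _ ≤ 1 / 18 := by
        have h := Real.exp_one_gt_d9
        have he : Real.exp (-3 : ℝ) = (Real.exp 1)⁻¹ ^ 3 := by
          rw [← Real.exp_neg, ← Real.exp_nat_mul]; norm_num
        rw [he]
        have h2 : (Real.exp 1)⁻¹ ≤ 10 / 27 := by
          rw [inv_eq_one_div, div_le_div_iff₀ (Real.exp_pos 1) (by norm_num)]; linarith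
        have h0 : 0 ≤ (Real.exp 1)⁻¹ := by positivity
        calc (Real.exp 1)⁻¹ ^ 3 ≤ (10 / 27 : ℝ) ^ 3 := pow_le_pow_left₀ h0 h2 3
          _ ≤ 1 / 18 := by norm_num

end

end Summit.RiemannHypothesis.RiemannHypothesis.Theorems.Splittings.ScrewLatticeTower
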